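import Literature.Barriers.ValiantsHypothesis.NotViaSaturations
import Literature.Computability.AlgebraicComplexity.OrbitClosureWeights
import HarnessLib

/-!
# Not via saturations — the Chow-variety decomposition of Bürgisser–Hüttenhain–Ikenmeyer's
# Theorem 1 (BHI 2017, §3)

Sibling of `NotViaSaturations.lean` (the barrier entry, which vendors BHI Thm. 1 as the named fact
`BHI2017_thm1`). This file records the ARCHITECTURE of the printed proof of Thm. 1 as named facts
(D-0014) and proves the assembly, so that the unproved content is localised in BHI's Theorem 3
about the Chow variety.

**The printed proof** (P. Bürgisser, J. Hüttenhain, C. Ikenmeyer, Proc. AMS 145 (2017),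
arXiv:1501.05528, §3; letters of the source, `n` = the determinant size = the tree's `m`).
"Let `X_1,…,X_n` be a basis of `V` and consider `w_n := X_1⋯X_n ∈ W`" (= `Sym^n V`);
`Chow_n := {v_1⋯v_n | v_i ∈ V}` "equals the `G`-orbit closure of `w_n`" (Lemma 2). "When we
identify `X_i` with the variable `X_{ii}`, then `Chow_n` is contained in the `Gl_{n²}`-orbit closure
`Det_n`. Indeed, let `ε ∈ ℂ^*`. The linear substitution `X_{ii} ↦ X_{ii}`, `X_{ij} ↦ εX_{ij}` for
`i ≠ j`, maps `det_n` to `X_{11}⋯X_{nn} + εp` for some polynomial `p`. We obtain `X_{11}⋯X_{nn}` in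
the limit when `ε` goes to zero. ... we have `S(Chow_n) ⊆ S(Det_n)` and hence
`Sat(S(Chow_n)) ⊆ Sat(S(Det_n))`. Our main Theorem 1 is an immediate consequence of the following
result. **Theorem 3.** We have `Sat(S(Chow_n)) = {λ ∈ Λ⁺_{Gl_n}(poly) | |λ| ≡ 0 mod n}`, provided
`n > 2`." Theorem 3 is proved from (5) `Sat(S) = A(S) ∩ C_ℚ(S)`, **Prop. 2** ("`S(Chow_n)`
generates the rational cone `{q ∈ ℚ^n | q_1 ≥ ⋯ ≥ q_n ≥ 0}`" — via the normalisation `V^n//H_n` of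
`Chow_n`, Prop. 1, Lemmas 3–4 and the even-plethysm theorem of [bci:10]; the proposition's
quantitative second sentence "More precisely: Assume `n > 2`. For each partition `λ` with
`ℓ(λ) ≤ n` and `|λ| ∈ nℕ`, there is some number `N < n^{n²-2n}` such that we have
`2N·λ ∈ S(Chow_n)`" is not used by Theorem 3 and is not vendored, see the docstring of
`BHI2017_prop2`) and **Prop. 3** ("`S(Chow_n)` generates the group
`{λ ∈ ℤ^n | ∑_{i=1}^n λ_i ≡ 0 mod n}` if `n > 2`" — via Lemmas 5–6 and two plethysm checks).

**Rendering** (conventions of `NotViaSaturations.lean` and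
`Literature/Computability/Complexity/OccurrenceObstructionsBIP.lean`). The Chow monoid is recorded
exactly like the tree's `detOccWeights m = S(Det_m)`: `chowOccWeights m` is the additive monoid of
weights `χ : Fin m → ℤ` of `GL_m` whose DUAL `χ^*` has a nonzero highest-weight vector in the
coordinate ring `ℂ[\overline{GL_m · X_0⋯X_{m-1}}]` (tree: `orbitCoordRep (chowMonomial ℂ m) m`, the
orbit closure taken in `Sym^m ℂ^m`, upper triangular Borel of `GL (Fin m) ℂ`); for
`χ = Weight.ofPartition m λ` this is "`λ ∈ S(Chow_m)`" (BHI (1): "`V_G(λ)^*` occurs in `𝒪(Z)`").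
The identification "`X_i` with `X_{ii}`" is, at the level of weights, the extension-by-zero map
`padWeight m : ℤ^m →+ ℤ^{m²}` onto the first `m` coordinates (a partition of length `≤ m` read as
a partition of length `≤ m²`: `padWeight_ofPartition`); the proof file realises it by the
order embedding of `Fin m` onto the greatest `m` matrix positions (the last row), which is what the
dual-weight convention of the tree requires. The group `L` of Prop. 3 is `bhiLattice m`.

**What is here.** Definitions `chowMonomial`, `chowOccWeights`, `padWeight`, `bhiLattice`; named
facts `BHI2017_chow_le_det` (`S(Chow_n) ⊆ S(Det_n)`, §3), `BHI2017_prop2` (the rational cone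
`C_ℚ(S(Chow_n))`, Prop. 2 first assertion), `BHI2017_prop3`, `BHI2017_thm3`; PROVED: the easy
inclusion `S(Chow_m) ⊆ {λ polynomial, m ∣ |λ|}` (`isPolynomial_of_mem_chowOccWeights`,
`size_dvd_of_mem_chowOccWeights`, from the tree's weight analysis of orbit closures),
functoriality of `Sat` (`map_mem_saturation`), Theorem 3 from Propositions 2 and 3
(`BHI2017_thm3_of_props`, the printed "Proof of Theorem 3"), and Theorem 1 from
`S(Chow_n) ⊆ S(Det_n)` and Theorem 3 (`BHI2017_thm1_of_chow`, the printed "immediate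
consequence"). The discharges live downstream: `BHI2017_chow_le_det` in
`NotViaSaturationsChowProofs.lean`; Prop. 3, Theorem 3, Theorem 1 and the cone assertion of
Prop. 2 in `NotViaSaturationsThm3.lean` (normalisation of the Chow variety and Brion's theorem,
`Literature/Computability/AlgebraicComplexity/Chow*.lean`), with the finer printed ingredients
(Prop. 1 for `Chow_n`, [bci:10], Lemmas 5–6) in `NotViaSaturationsChowNormal*.lean` and
`NotViaSaturationsEvenPlethysmProofs.lean`.

## References

* [BurgisserHuttenhainIkenmeyer2017] P. Bürgisser, J. Hüttenhain, C. Ikenmeyer, *Permanent versus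
  determinant: not via saturations*, Proc. AMS 145 (2017) 1247–1258 = arXiv:1501.05528: §1 ((1),
  "`|λ| ≡ 0 mod n` for any `λ ∈ S(Z)`"), §2 ((5)), §3 (Lemma 2, "`Chow_n` is contained in ...
  `Det_n`", "`S(Chow_n) ⊆ S(Det_n)`", Thm. 3, Prop. 2, Prop. 3 and its proof, Proof of Thm. 3,
  Rem. 3).
* [BurgisserEtAl2011] BLMW, SIAM J. Comput. 40 (2011), (5.2.2) (occurring weights are partitions;
  tree: `exists_eq_dualOfPartition_of_hasHighestWeight_orbitCoordRep`).
-/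

noncomputable section

open MvPolynomial

namespace Literature.Barriers.ValiantsHypothesis

open Literature.NumberTheory.DiophantineGeometry Literature.Computability.AlgebraicComplexity
  Literature.Computability.Complexity

/-! ### The Chow monoid `S(Chow_m)` -/

/-- BHI's `w_n := X_1⋯X_n`, the product of the variables, whose `GL_n`-orbit closure in
`Sym^n ℂ^n` is the Chow variety `Chow_n` of products of `n` linear forms (BHI Lemma 2).
[cite: BurgisserHuttenhainIkenmeyer2017, §3 (w_n and Lemma 2)] -/
def chowMonomial (k : Type*) [CommSemiring k] (m : ℕ) : MvPolynomial (Fin m) k :=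
  ∏ i : Fin m, X i

/-- `w_m` is the monomial `X^{(1,…,1)}`. [folklore] -/
theorem chowMonomial_eq_monomial (k : Type*) [CommSemiring k] (m : ℕ) :
    chowMonomial k m = monomial (Finsupp.equivFunOnFinite.symm fun _ => 1) 1 := by
  rw [chowMonomial, monomial_eq, C_1, one_mul, Finsupp.prod_fintype _ _ (fun i => pow_zero _)]
  simp

/-- `w_m` is homogeneous of degree `m`. [folklore] -/
theorem chowMonomial_isHomogeneous (k : Type*) [CommSemiring k] (m : ℕ) :
    (chowMonomial k m).IsHomogeneous m := by
  have h : (chowMonomial k m).IsHomogeneous (∑ i : Fin m, 1) := by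
    rw [chowMonomial]
    exact IsHomogeneous.prod Finset.univ (fun i => X i) (fun _ => 1) fun i _ => isHomogeneous_X k i
  simpa using h

/-- The dual of a sum of weights is the sum of the duals. [folklore] -/
theorem _root_.Literature.NumberTheory.DiophantineGeometry.Weight.dual_add {N : ℕ}
    (χ ψ : Weight (Fin N)) : (χ + ψ).dual = χ.dual + ψ.dual := by
  funext i
  simp [Weight.dual, add_comm]

/-- The dual of the zero weight is zero. [folklore] -/
theorem _root_.Literature.NumberTheory.DiophantineGeometry.Weight.dual_zero {N : ℕ} :
    (0 : Weight (Fin N)).dual = 0 := by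
  funext i
  simp [Weight.dual]

/-- The dual of a multiple is the multiple of the dual. [folklore] -/
theorem _root_.Literature.NumberTheory.DiophantineGeometry.Weight.dual_nsmul {N : ℕ} (n : ℕ)
    (χ : Weight (Fin N)) : (n • χ).dual = n • χ.dual := by
  funext i
  simp [Weight.dual]

/-- **The monoid of representations `S(Chow_m)` of the Chow variety** (BHI (1) with
`Z = Chow_m = \overline{GL_m · X_0⋯X_{m-1}} ⊆ Sym^m ℂ^m`): the weights `χ ∈ ℤ^m` of `GL_m(ℂ)` such
that `V(χ)^*` occurs in `𝒪(Chow_m)`, i.e. the dual weight `χ^*` has a nonzero highest-weight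
vector in the coordinate ring of the orbit closure of `w_m` (tree: `orbitCoordRep`), recorded —
exactly as the tree's `detOccWeights m = S(Det_m)` — as an additive submonoid (closed under
addition by the semigroup property of orbit closures, `HasHighestWeight.add_of_orbitCoordRep`;
BHI: "`S(Z)` is a finitely generated submonoid"). For `χ = Weight.ofPartition m λ`,
`ℓ(λ) ≤ m`, membership is "`λ ∈ S(Chow_m)`".
[cite: BurgisserHuttenhainIkenmeyer2017, §1 (1) and §3 (Chow_n)] -/
def chowOccWeights (m : ℕ) : AddSubmonoid (Weight (Fin m)) where
  carrier := {χ | HasHighestWeight (orbitCoordRep (chowMonomial ℂ m) m) χ.dual}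
  add_mem' {χ ψ} hχ hψ := by
    simp only [Set.mem_setOf_eq] at hχ hψ ⊢
    rw [Weight.dual_add]
    exact HasHighestWeight.add_of_orbitCoordRep _ m hχ hψ
  zero_mem' := by
    simp only [Set.mem_setOf_eq]
    rw [Weight.dual_zero]
    exact hasHighestWeight_orbitCoordRep_zero _ m

/-- Membership in `S(Chow_m)`, unfolded. [cite: BurgisserHuttenhainIkenmeyer2017, §1 (1)] -/
theorem mem_chowOccWeights_iff (m : ℕ) (χ : Weight (Fin m)) :
    χ ∈ chowOccWeights m ↔ HasHighestWeight (orbitCoordRep (chowMonomial ℂ m) m) χ.dual :=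
  Iff.rfl

/-! ### `S(Chow_m)` lies in `{λ ∈ Λ⁺(poly) : m ∣ |λ|}` (BHI §1, "easy to see") -/

/-- The size `|χ| = ∑ χ_i` of a weight as an additive homomorphism. [folklore] -/
def sizeAddHom (σ : Type*) [Fintype σ] : Weight σ →+ ℤ where
  toFun χ := χ.size
  map_zero' := by simp [Weight.size]
  map_add' χ ψ := by simp [Weight.size, Finset.sum_add_distrib]

/-- Unfolding of `sizeAddHom`. [folklore] -/
@[simp]
theorem sizeAddHom_apply {σ : Type*} [Fintype σ] (χ : Weight σ) : sizeAddHom σ χ = χ.size :=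
  rfl

/-- BHI's group `L := {λ ∈ ℤ^n | ∑_i λ_i ≡ 0 mod n}` (proof of Prop. 3), as an additive subgroup
of `ℤ^m`. [cite: BurgisserHuttenhainIkenmeyer2017, Prop. 3 (the group L)] -/
def bhiLattice (m : ℕ) : AddSubgroup (Weight (Fin m)) :=
  (AddSubgroup.zmultiples (m : ℤ)).comap (sizeAddHom (Fin m))

/-- Membership in `L`: `m ∣ |χ|`. [cite: BurgisserHuttenhainIkenmeyer2017, Prop. 3] -/
theorem mem_bhiLattice_iff (m : ℕ) (χ : Weight (Fin m)) :
    χ ∈ bhiLattice m ↔ (m : ℤ) ∣ χ.size := by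
  rw [bhiLattice, AddSubgroup.mem_comap, sizeAddHom_apply, Int.mem_zmultiples_iff]

/-- **Occurring weights of `𝒪(Chow_m)` are polynomial** (partitions with at most `m` parts):
"`S(Z)` is a finitely generated submonoid of `Λ⁺_G(poly)`". From the tree's weight analysis of
orbit closures over an infinite field (`isDominant_of_hasHighestWeight_orbitCoordRep`,
`nonpos_and_exists_size_eq_of_hasHighestWeight_orbitCoordRep`: the dual weight is dominant and
nonpositive). [cite: BurgisserHuttenhainIkenmeyer2017, §1 (S(Z) ⊆ Λ⁺_G(poly))] -/
theorem isPolynomial_of_mem_chowOccWeights {m : ℕ} {χ : Weight (Fin m)}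
    (h : χ ∈ chowOccWeights m) : χ.IsPolynomial := by
  rw [mem_chowOccWeights_iff] at h
  have hdom : χ.dual.IsDominant := isDominant_of_hasHighestWeight_orbitCoordRep _ h
  have hnonpos := (nonpos_and_exists_size_eq_of_hasHighestWeight_orbitCoordRep _ h).1
  refine ⟨(Weight.isDominant_dual_iff_holds χ).mp hdom, fun i => ?_⟩
  have hi := hnonpos (Fin.rev i)
  simp only [Weight.dual, Fin.rev_rev, Left.neg_nonpos_iff] at hi
  exact hi

/-- **`|λ| ≡ 0 mod m` for every `λ ∈ S(Chow_m)`**: "if `Z` is the orbit closure of some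
`h ∈ Pol_n`, then it is easy to see that `|λ| ≡ 0 mod n` for any `λ ∈ S(Z)`" (a weight pins the
degree `D`, and `|λ| = D·m`). [cite: BurgisserHuttenhainIkenmeyer2017, §1] -/
theorem size_dvd_of_mem_chowOccWeights {m : ℕ} {χ : Weight (Fin m)}
    (h : χ ∈ chowOccWeights m) : (m : ℤ) ∣ χ.size := by
  rw [mem_chowOccWeights_iff] at h
  obtain ⟨D, hD⟩ := (nonpos_and_exists_size_eq_of_hasHighestWeight_orbitCoordRep _ h).2
  rw [Weight.size_dual, neg_eq_iff_eq_neg, neg_neg] at hD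
  exact ⟨D, by rw [hD]; push_cast; ring⟩

/-- `S(Chow_m) ⊆ L`. [cite: BurgisserHuttenhainIkenmeyer2017, Prop. 3 ("A ⊆ L is obvious")] -/
theorem chowOccWeights_subset_bhiLattice (m : ℕ) :
    (chowOccWeights m : Set (Weight (Fin m))) ⊆ bhiLattice m := fun _ h =>
  (mem_bhiLattice_iff m _).mpr (size_dvd_of_mem_chowOccWeights h)

/-- Hence `A(S(Chow_m)) ⊆ L` ("Since `A ⊆ L` is obvious").
[cite: BurgisserHuttenhainIkenmeyer2017, Prop. 3 (proof)] -/
theorem closure_chowOccWeights_le_bhiLattice (m : ℕ) :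
    AddSubgroup.closure (chowOccWeights m : Set (Weight (Fin m))) ≤ bhiLattice m :=
  (AddSubgroup.closure_le _).mpr (chowOccWeights_subset_bhiLattice m)

/-! ### `Chow_n ⊆ Det_n` at the level of weights: `padWeight` -/

/-- The identification of a weight `χ ∈ ℤ^m` of `GL_m` with the weight `(χ, 0, …, 0) ∈ ℤ^{m²}` of
`GL_{m²}` (a partition of length `≤ m` read as a partition of length `≤ m²`; BHI: "When we
identify `X_i` with the variable `X_{ii}` ..."), as an additive homomorphism.
[cite: BurgisserHuttenhainIkenmeyer2017, §3 (identification of X_i with X_ii)] -/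
def padWeight (m : ℕ) : Weight (Fin m) →+ Weight (Fin (m * m)) where
  toFun χ i := if h : (i : ℕ) < m then χ ⟨i, h⟩ else 0
  map_zero' := by
    funext i
    simp
  map_add' χ ψ := by
    funext i
    simp only [Pi.add_apply]
    split_ifs <;> simp

/-- Unfolding of `padWeight`. [cite: BurgisserHuttenhainIkenmeyer2017, §3] -/
theorem padWeight_apply (m : ℕ) (χ : Weight (Fin m)) (i : Fin (m * m)) :
    padWeight m χ i = if h : (i : ℕ) < m then χ ⟨i, h⟩ else 0 :=
  rfl

/-- `padWeight` is injective. [folklore] -/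
theorem padWeight_injective (m : ℕ) : Function.Injective (padWeight m) := by
  intro χ ψ h
  funext j
  have hj : (j : ℕ) < m * m := lt_of_lt_of_le j.2 (Nat.le_mul_self m)
  have := congr_fun h ⟨j, hj⟩
  simpa [padWeight_apply, j.2] using this

/-- The weight of a partition `λ` with at most `m` parts in `GL_{m²}` is the padding of its weight
in `GL_m`. [folklore] -/
theorem padWeight_ofPartition {m D : ℕ} (lam : Nat.Partition D) (hlam : lam.parts.card ≤ m) :
    padWeight m (Weight.ofPartition m lam) = Weight.ofPartition (m * m) lam := by
  funext i
  rw [padWeight_apply]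
  split_ifs with h
  · rfl
  · rw [Weight.ofPartition_apply, List.getD_eq_default _ _ (by
      rw [Nat.Partition.length_sortedParts]; omega)]
    simp

/-! ### Functoriality of the saturation -/

section SaturationMap

variable {M M' : Type*} [AddCommGroup M] [AddCommGroup M']

/-- If an additive homomorphism `φ` maps the monoid `S` into the monoid `S'`, it maps `A(S)` into
`A(S')`, `C_ℚ(S)` into `C_ℚ(S')`, hence `Sat(S)` into `Sat(S')` (BHI: "`S(Chow_n) ⊆ S(Det_n)` and
hence `Sat(S(Chow_n)) ⊆ Sat(S(Det_n))`", the inclusion being `padWeight`).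
[cite: BurgisserHuttenhainIkenmeyer2017, §3 (Sat(S(Chow_n)) ⊆ Sat(S(Det_n)))] -/
theorem map_mem_saturation (φ : M →+ M') {S : AddSubmonoid M} {S' : AddSubmonoid M'}
    (hφ : ∀ x ∈ S, φ x ∈ S') {x : M} (hx : x ∈ saturation S) : φ x ∈ saturation S' := by
  obtain ⟨hxA, k, hk, hkx⟩ := hx
  refine ⟨?_, k, hk, by rw [← map_nsmul]; exact hφ _ hkx⟩
  have h1 : φ x ∈ (AddSubgroup.closure (S : Set M)).map φ := AddSubgroup.mem_map_of_mem φ hxA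
  rw [AddMonoidHom.map_closure] at h1
  refine (AddSubgroup.closure_mono ?_) h1
  rintro _ ⟨y, hy, rfl⟩
  exact hφ y hy

end SaturationMap

/-! ### The printed results as named facts (D-0014) -/

/-- **`S(Chow_n) ⊆ S(Det_n)`** (BHI §3): "When we identify `X_i` with the variable `X_{ii}`, then
`Chow_n` is contained in the `Gl_{n²}`-orbit closure `Det_n`. ... More specifically, we have
`S(Chow_n) ⊆ S(Det_n)` and hence `Sat(S(Chow_n)) ⊆ Sat(S(Det_n))`." Tree letters: for every `m`
and every weight `χ ∈ S(Chow_m)` of `GL_m`, the padded weight `(χ, 0, …, 0)` of `GL_{m²}` lies in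
`S(Det_m) = detOccWeights m`. (Behind the one printed sentence: `X_{11}⋯X_{nn} ∈ Det_n`, restriction
of regular functions and Schur's lemma (BHI §1 (2)), and inheritance from `GL_n` on `Sym^n ℂ^n`
to `GL_{n²}` on `Sym^n ℂ^{n²}` for weights of length `≤ n`. Discharged in
`NotViaSaturationsChowProofs.lean`.) [cite: BurgisserHuttenhainIkenmeyer2017, §3 (S(Chow_n) ⊆ S(Det_n))] -/
def BHI2017_chow_le_det : Prop :=
  ∀ (m : ℕ) (χ : Weight (Fin m)), χ ∈ chowOccWeights m → padWeight m χ ∈ detOccWeights m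

/-- **BHI Prop. 2 (the rational cone generated by `S(Chow_n)`).** "`S(Chow_n)` generates the
rational cone `{q ∈ ℚ^n | q_1 ≥ ⋯ ≥ q_n ≥ 0}`." Rendered in the weight lattice `ℤ^m` with BHI's
`C_ℚ(S) = {k⁻¹ s | k ∈ ℕ_{>0}, s ∈ S}` (§2 before (5); tree: `ratCone`, so that (5) reads
`saturation S = A(S) ∩ ratCone S`): the weights of `GL_m` having a positive multiple in `S(Chow_m)`
are exactly the polynomial dominant weights `χ_1 ≥ ⋯ ≥ χ_m ≥ 0` (`Weight.IsPolynomial`, the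
lattice points of the printed cone) — equivalent to the printed sentence since
`S(Chow_m) ⊆ Λ⁺_{GL_m}(poly)` (`isPolynomial_of_mem_chowOccWeights`) and denominators clear. This
is the assertion of Prop. 2 that the printed "Proof of Theorem 3" consumes ("This follows from
Proposition 2 and Proposition 3, using (5)"). Proof in print: "According to Proposition 1, the
semigroups `S(Chow_n)` and `S(V^n//H_n)` generate the same rational cone" (normalisation `ψ_n`,
Lemma 3), Lemma 4, and "[bci:10] ... `V_{Gl_n}(2λ)` occurs in `Sym^nSym^{2k}(ℂ^n)`".
Scope: the proposition's quantitative second sentence — "More precisely: Assume `n > 2`. For each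
partition `λ` with `ℓ(λ) ≤ n` and `|λ| ∈ nℕ`, there is some number `N < n^{n²-2n}` such that we
have `2N·λ ∈ S(Chow_n)`" — is NOT vendored here: Theorems 1 and 3 do not use it, and its printed
proof goes through the second part of Prop. 1 ("for all `λ ∈ S(Z̃)`, there is some `i < e` such
that `(e-i)·λ ∈ S(Z)`", `e` the number of `𝒪(Z)`-module generators of `𝒪(Z̃)`, argued from the
minimal polynomial of a highest weight vector `f ∈ 𝒪(Z̃)` over `𝒪(Z)`), the Cohen–Macaulayness of
`𝒪(V^n)^{H_n}` and its freeness of rank `D = (n²-n)!/(n!(n-1)!^n)` over a Noether normalisation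
of `𝒪(Chow_n)` by generic linear forms [dk:02], and a Stirling estimate `D < n^{n²-2n}` (`n ≥ 3`);
cf. §1.1: "our proof gives information on the stretching factor in terms of certain degrees related
to the normalization the Chow variety. Unfortunately, we were so far unable to bound the latter in
a reasonable way." [cite: BurgisserHuttenhainIkenmeyer2017, Prop. 2 (first assertion, and proof)] -/
def BHI2017_prop2 : Prop :=
  ∀ (m : ℕ), 0 < m → ratCone (chowOccWeights m) = {χ : Weight (Fin m) | χ.IsPolynomial}

/-- **BHI Prop. 3 (the group).** "`S(Chow_n)` generates the group
`{λ ∈ ℤ^n | ∑_{i=1}^n λ_i ≡ 0 mod n}` if `n > 2`." (Proof in print: generators `λ^{(1)} = (n)`,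
`λ^{(2)} = (n-1,1) = (3n-3,3) - (2n-2,2)` (Schur-program checks in `Sym^3Sym^3`, `Sym^2Sym^2`,
Lemma 5), `λ^{(k)}`, `3 ≤ k ≤ n`, from Lemma 6 (inheritance, Manivel–Michałek Cor. 6.4), all via
Lemma 4 and Prop. 1; "`(3,3,0,…,0)` does not occur in `Sym^2Sym^3V`; this is the reason for the
assumption `n > 2`".) [cite: BurgisserHuttenhainIkenmeyer2017, Prop. 3] -/
def BHI2017_prop3 : Prop :=
  ∀ (m : ℕ), 2 < m → AddSubgroup.closure (chowOccWeights m : Set (Weight (Fin m))) = bhiLattice m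

/-- **BHI Thm. 3.** "We have `Sat(S(Chow_n)) = {λ ∈ Λ⁺_{Gl_n}(poly) | |λ| ≡ 0 mod n}`, provided
`n > 2`." With `Sat` of `NotViaSaturations.lean` ((5): `Sat(S) = A(S) ∩ C_ℚ(S)`) and
`Λ⁺_{Gl_m}(poly)` = `Weight.IsPolynomial` (dominant, nonnegative entries). Rem. 3: "The assumption
`n > 2` in Theorem 3 is necessary" (`S(Sym²ℂ²)` generates `{λ₁ ≡ λ₂ ≡ 0 mod 2}`).
[cite: BurgisserHuttenhainIkenmeyer2017, Thm. 3] -/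
def BHI2017_thm3 : Prop :=
  ∀ (m : ℕ), 2 < m →
    saturation (chowOccWeights m) = {χ : Weight (Fin m) | χ.IsPolynomial ∧ (m : ℤ) ∣ χ.size}

/-! ### The assembly, proved: Thm. 3 from Props. 2–3, Thm. 1 from `S(Chow) ⊆ S(Det)` and Thm. 3 -/

/-- A positive multiple of a weight is polynomial only if the weight is. [folklore] -/
theorem _root_.Literature.NumberTheory.DiophantineGeometry.Weight.IsPolynomial.of_nsmul {N k : ℕ}
    {χ : Weight (Fin N)} (hk : 0 < k) (h : (k • χ).IsPolynomial) : χ.IsPolynomial := by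
  have hk' : (0 : ℤ) < k := by exact_mod_cast hk
  refine ⟨fun i j hij => ?_, fun i => ?_⟩
  · have := h.1 hij
    simp only [Pi.smul_apply, nsmul_eq_mul] at this
    exact le_of_mul_le_mul_left this hk'
  · have := h.2 i
    simp only [Pi.smul_apply, nsmul_eq_mul] at this
    exact nonneg_of_mul_nonneg_right this hk'

/-- **Proof of Theorem 3** ("This follows from Proposition 2 and Proposition 3, using (5)"):
`Sat(S(Chow_m)) = A(S(Chow_m)) ∩ C_ℚ(S(Chow_m)) = L ∩ Λ⁺_{GL_m}(poly)` by Prop. 3 (the group) and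
Prop. 2 (the cone). [cite: BurgisserHuttenhainIkenmeyer2017, Proof of Thm. 3] -/
theorem BHI2017_thm3_of_props (h₂ : BHI2017_prop2) (h₃ : BHI2017_prop3) : BHI2017_thm3 := by
  intro m hm
  ext χ
  rw [saturation, h₃ m hm, h₂ m (by omega), Set.mem_inter_iff, SetLike.mem_coe, mem_bhiLattice_iff,
    Set.mem_setOf_eq, Set.mem_setOf_eq, and_comm]

/-- **Theorem 1 from the Chow variety** ("Our main Theorem 1 is an immediate consequence of"
Theorem 3, given `S(Chow_n) ⊆ S(Det_n)`): for `m > 2` and `λ ⊢ D` with `ℓ(λ) ≤ m`, `m ∣ D`, the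
weight of `λ` for `GL_m` is polynomial of size `D`, hence in `Sat(S(Chow_m))` by Theorem 3, and
`padWeight` carries `Sat(S(Chow_m))` into `Sat(S(Det_m))` (`map_mem_saturation`) and the weight of
`λ` for `GL_m` to its weight for `GL_{m²}` (`padWeight_ofPartition`).
[cite: BurgisserHuttenhainIkenmeyer2017, §3 (Thm. 1 from Thm. 3)] -/
theorem BHI2017_thm1_of_chow (h₁ : BHI2017_chow_le_det) (h₃ : BHI2017_thm3) : BHI2017_thm1 := by
  intro m hm D lam hcard hdvd
  have hmem : Weight.ofPartition m lam ∈ saturation (chowOccWeights m) := by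
    rw [h₃ m hm, Set.mem_setOf_eq, Weight.size_ofPartition_holds hcard]
    exact ⟨Weight.isPolynomial_ofPartition_holds m lam, Int.natCast_dvd_natCast.mpr hdvd⟩
  rw [← padWeight_ofPartition lam hcard]
  exact map_mem_saturation (padWeight m) (h₁ m) hmem

/-- The same with Theorem 3 replaced by its printed ingredients Props. 2 and 3.
[cite: BurgisserHuttenhainIkenmeyer2017, §3] -/
theorem BHI2017_thm1_of_props (h₁ : BHI2017_chow_le_det) (h₂ : BHI2017_prop2)
    (h₃ : BHI2017_prop3) : BHI2017_thm1 :=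
  BHI2017_thm1_of_chow h₁ (BHI2017_thm3_of_props h₂ h₃)

end Literature.Barriers.ValiantsHypothesis
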